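import Summits.QuantumFields.GaugeBoot.DiagonalRPTorusTubeTerms
import HarnessLib

/-!
# Gluing a transverse square to the ring above it (gauge-boot, L3 sequel, 10/12)

HONEST FRAMING (cell `pub-gaugeboot`, page 1 of every file): the venture produces certified bounds
on lattice expectations at stated coupling, gauge group, dimension and torus size; NOT a mass gap,
NOT a continuum limit, NOT a string tension; NOT Yang–Mills-summit-bearing (barriers
`FixedCouplingUltralocality`, `PerturbativeInvisibility`). This module is bookkeeping for a
structural NEGATIVE result (`DiagonalRPTorusInnerHalfNegativeHighDim`); it discharges nothing by
itself.

## Content (torus `(ℤ/L)^d`, `L ≥ 3`, directions `m < k < l`, compact metrisable `G`,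
continuous `ρ` with the character identity (R1) `∫ Re χ(x g⁻¹) Re χ(g y) dg = c₁ Re χ(x y)`)

* **`glue`** — the one-link CONVOLUTION STEP under the product Haar integral: if replacing the
  link `e` by `s` factors the integrand as `H · Re χ(a₁ s⁻¹ b₁) · Re χ(a₂ s b₂)`, the integral
  is `c₁ ∫ H · Re χ(b₁ a₁ b₂ a₂)`;
* ★ **`ring_collapse`** — integrating out the four edges of the transverse square `sq y` (and,
  silently, three longitudinal links) glues the square to the four ring faces `ring m y ·`:
  `∫ H · Re χ(U_{sq y}) ∏ₐ Re χ(U_{ring m y a}) = c₁⁴ ∫ H · Re χ(U_{sq (y+e_m)})` for every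
  continuous `H` not reading links based at `m`-height `y_m` (four `glue` steps; after each one
  the boundary word of the glued disc is re-presented, by cyclicity and conjugation invariance of
  `Re χ`, with the next edge exposed).

Folklore strong-coupling integration (Creutz, *Quarks, gluons and lattices* (1983) §8–§10);
no definition of record, no named fact.
-/

open MeasureTheory Finset Function

namespace Summit.QuantumFields.GaugeBoot

open Literature.MathematicalPhysics.QuantumFieldTheory
open Literature.MathematicalPhysics.QuantumFieldTheory.PlaquetteLowerBound (reTr)

noncomputable section

namespace DiagRPTube

variable {d L : ℕ} [NeZero L] {N : ℕ} {G : Type*} [Group G] [TopologicalSpace G]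
  [IsTopologicalGroup G] [CompactSpace G] [MeasurableSpace G] [BorelSpace G]
  [SecondCountableTopology G] (ρ : G →* Matrix (Fin N) (Fin N) ℂ)

/-! ## The convolution step -/

section Glue

omit [NeZero L] [MeasurableSpace G] [BorelSpace G] [SecondCountableTopology G] [TopologicalSpace G]
  [IsTopologicalGroup G] [CompactSpace G] in
/-- `Re χ(a g b) = Re χ(g (b a))`. -/
theorem reTr_cycle (a g b : G) : reTr ρ (a * g * b) = reTr ρ (g * (b * a)) := by
  rw [mul_assoc, DiagRPSUN.reTr_mul_comm ρ a (g * b), mul_assoc]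

omit [NeZero L] [MeasurableSpace G] [BorelSpace G] [SecondCountableTopology G] [TopologicalSpace G]
  [IsTopologicalGroup G] [CompactSpace G] in
/-- `Re χ(g x g⁻¹) = Re χ(x)`. -/
theorem reTr_conj (g x : G) : reTr ρ (g * x * g⁻¹) = reTr ρ x := by
  rw [DiagRPSUN.reTr_mul_comm ρ (g * x) g⁻¹, inv_mul_cancel_left]

omit [SecondCountableTopology G] in
/-- ★ **Glue.** If updating the link `e` to `s` factors the integrand as
`H(U) · Re χ(a₁ s⁻¹ b₁) · Re χ(a₂ s b₂)`, then `∫ F = c₁ ∫ H · Re χ(b₁ a₁ (b₂ a₂))` under (R1). -/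
theorem glue {c₁ : ℝ}
    (hR1 : ∀ x y : G, ∫ g, reTr ρ (x * g⁻¹) * reTr ρ (g * y) ∂haarProbability G = c₁ * reTr ρ (x * y))
    (e : Edge d L) {F : GaugeConfig d L G → ℝ}
    (hF : Integrable F (Measure.pi fun _ : Edge d L => haarProbability G))
    (H : GaugeConfig d L G → ℝ) (a₁ b₁ a₂ b₂ : GaugeConfig d L G → G)
    (h : ∀ (U : GaugeConfig d L G) (s : G),
      F (update U e s) = H U * (reTr ρ (a₁ U * s⁻¹ * b₁ U) * reTr ρ (a₂ U * s * b₂ U))) :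
    ∫ U, F U ∂Measure.pi (fun _ : Edge d L => haarProbability G) =
      c₁ * ∫ U, H U * reTr ρ (b₁ U * a₁ U * (b₂ U * a₂ U))
        ∂Measure.pi (fun _ : Edge d L => haarProbability G) := by
  rw [← integral_const_mul]
  refine DiagRPSUN.integral_pi_update_of_forall (haarProbability G) e hF fun U => ?_
  simp_rw [h]
  rw [integral_const_mul]
  have h1 : ∀ s : G, reTr ρ (a₁ U * s⁻¹ * b₁ U) = reTr ρ (b₁ U * a₁ U * s⁻¹) := fun s => by
    rw [reTr_cycle, DiagRPSUN.reTr_mul_comm]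
  have h2 : ∀ s : G, reTr ρ (a₂ U * s * b₂ U) = reTr ρ (s * (b₂ U * a₂ U)) := fun s => reTr_cycle ρ _ _ _
  simp_rw [h1, h2]
  rw [hR1]
  ring

end Glue

/-! ## Collapsing a ring onto its square -/

section Collapse

variable {m k l : Fin d} (hmk : m < k) (hml : m < l) (hkl : k < l) (hL : 3 ≤ L) (hρ : Continuous ρ)
  {c₁ : ℝ}
  (hR1 : ∀ x y : G, ∫ g, reTr ρ (x * g⁻¹) * reTr ρ (g * y) ∂haarProbability G = c₁ * reTr ρ (x * y))
  (y : Site d L) {H : GaugeConfig d L G → ℝ} (hH : Continuous H)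
  (hHm : ∀ e : Edge d L, e.1 m = y m → ∀ (U : GaugeConfig d L G) (s : G), H (update U e s) = H U)

include hmk hml hkl hL hρ hR1 hH hHm

set_option linter.unusedSimpArgs false in
/-- ★ **Ring collapse.** Integrating out the square `sq y` and the ring `ring m y ·`:
`∫ H · Re χ(U_{sq y}) · ∏ₐ Re χ(U_{ring m y a}) = c₁⁴ ∫ H · Re χ(U_{sq (y + e_m)})`. -/
theorem ring_collapse :
    ∫ U, H U * WilsonRP.plaqRe ρ U (sq k l hkl y) * ∏ a : Fin 4, WilsonRP.plaqRe ρ U (ring hmk hml y a)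
        ∂Measure.pi (fun _ : Edge d L => haarProbability G) =
      c₁ ^ 4 * ∫ U, H U * WilsonRP.plaqRe ρ U (sq k l hkl (y.shift m))
        ∂Measure.pi (fun _ : Edge d L => haarProbability G) := by
  -- direction facts
  have hmk' : m ≠ k := ne_of_lt hmk
  have hml' : m ≠ l := ne_of_lt hml
  have hkl' : k ≠ l := ne_of_lt hkl
  have hkm : k ≠ m := hmk'.symm
  have hlm : l ≠ m := hml'.symm
  have hlk : l ≠ k := hkl'.symm
  have hinv : ∀ g : G, reTr ρ g⁻¹ = reTr ρ g := fun g =>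
    Literature.RepresentationTheory.CompactGroups.CompactGroup.re_trace_map_inv ρ hρ g
  -- site facts (`L ≥ 3`)
  have s01 : y.shift k ≠ y := shift_ne hL y k
  have s02 : y.shift l ≠ y := shift_ne hL y l
  have s03 : y.shift m ≠ y := shift_ne hL y m
  have s04 : (y.shift m).shift k ≠ y := shift_shift_ne' hL y hmk'
  have s05 : (y.shift m).shift l ≠ y := shift_shift_ne' hL y hml'
  have s06 : (y.shift k).shift l ≠ y := shift_shift_ne' hL y hkl'
  have s12 : y.shift k ≠ y.shift l := fun h => hkl' (shift_injective_dir hL y h)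
  have s13 : y.shift k ≠ y.shift m := fun h => hkm (shift_injective_dir hL y h)
  have s23 : y.shift l ≠ y.shift m := fun h => hlm (shift_injective_dir hL y h)
  have s14 : (y.shift m).shift k ≠ y.shift k := by
    rw [WilsonRP.shift_comm]; exact shift_ne hL _ m
  have s25 : (y.shift m).shift l ≠ y.shift l := by
    rw [WilsonRP.shift_comm]; exact shift_ne hL _ m
  have s34 : (y.shift m).shift k ≠ y.shift m := shift_ne hL _ k
  have s35 : (y.shift m).shift l ≠ y.shift m := shift_ne hL _ l
  have s16 : (y.shift k).shift l ≠ y.shift k := shift_ne hL _ l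
  have s26 : (y.shift k).shift l ≠ y.shift l := by
    rw [WilsonRP.shift_comm]; exact shift_ne hL _ k
  have s24 : (y.shift m).shift k ≠ y.shift l := by
    intro h
    have := congrFun h m
    simp [Site.shift, Pi.single_eq_of_ne hmk', Pi.single_eq_of_ne hml',
      Summit.Ventures.YMGap.RobustBall.one_ne_zero_of_three_le hL] at this
  have s15 : (y.shift m).shift l ≠ y.shift k := by
    intro h
    have := congrFun h m
    simp [Site.shift, Pi.single_eq_of_ne hmk', Pi.single_eq_of_ne hml',
      Summit.Ventures.YMGap.RobustBall.one_ne_zero_of_three_le hL] at this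
  have t01 := s01.symm; have t02 := s02.symm; have t03 := s03.symm; have t04 := s04.symm
  have t05 := s05.symm; have t06 := s06.symm; have t12 := s12.symm; have t13 := s13.symm
  have t23 := s23.symm; have t14 := s14.symm; have t25 := s25.symm; have t34 := s34.symm
  have t35 := s35.symm; have t16 := s16.symm; have t26 := s26.symm; have t24 := s24.symm
  have t15 := s15.symm
  -- the faces in letters (double shifts normalised to `(y + e_m) + e_·` and `(y + e_k) + e_l`)
  have hS0 : ∀ U : GaugeConfig d L G, WilsonRP.plaqRe ρ U (sq k l hkl y) =
      reTr ρ (U (y, k) * U (y.shift k, l) * (U (y.shift l, k))⁻¹ * (U (y, l))⁻¹) := fun U => rfl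
  have hS1 : ∀ U : GaugeConfig d L G, WilsonRP.plaqRe ρ U (sq k l hkl (y.shift m)) =
      reTr ρ (U (y.shift m, k) * U ((y.shift m).shift k, l) * (U ((y.shift m).shift l, k))⁻¹ *
        (U (y.shift m, l))⁻¹) := fun U => rfl
  have hF0 : ∀ U : GaugeConfig d L G, WilsonRP.plaqRe ρ U (ring hmk hml y 0) =
      reTr ρ (U (y, m) * U (y.shift m, k) * (U (y.shift k, m))⁻¹ * (U (y, k))⁻¹) := fun U => rfl
  have hF1 : ∀ U : GaugeConfig d L G, WilsonRP.plaqRe ρ U (ring hmk hml y 1) =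
      reTr ρ (U (y.shift k, m) * U ((y.shift m).shift k, l) * (U ((y.shift k).shift l, m))⁻¹ *
        (U (y.shift k, l))⁻¹) := fun U => by
    rw [WilsonRP.shift_comm y m k]; rfl
  have hF2 : ∀ U : GaugeConfig d L G, WilsonRP.plaqRe ρ U (ring hmk hml y 2) =
      reTr ρ (U (y.shift l, m) * U ((y.shift m).shift l, k) * (U ((y.shift k).shift l, m))⁻¹ *
        (U (y.shift l, k))⁻¹) := fun U => by
    rw [WilsonRP.shift_comm y m l, WilsonRP.shift_comm y k l]; rfl
  have hF3 : ∀ U : GaugeConfig d L G, WilsonRP.plaqRe ρ U (ring hmk hml y 3) =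
      reTr ρ (U (y, m) * U (y.shift m, l) * (U (y.shift l, m))⁻¹ * (U (y, l))⁻¹) := fun U => rfl
  have hfour : ∀ U : GaugeConfig d L G, ∏ a : Fin 4, WilsonRP.plaqRe ρ U (ring hmk hml y a) =
      WilsonRP.plaqRe ρ U (ring hmk hml y 0) * WilsonRP.plaqRe ρ U (ring hmk hml y 1) *
        WilsonRP.plaqRe ρ U (ring hmk hml y 2) * WilsonRP.plaqRe ρ U (ring hmk hml y 3) := fun U => by
    rw [Fin.prod_univ_four]
  -- frozen ring faces: a ring face contains only its own edge of the square
  have hfro : ∀ (a b : Fin 4), b ≠ a → ∀ (U : GaugeConfig d L G) (s : G),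
      WilsonRP.plaqRe ρ (update U (link (sq k l hkl y) a) s) (ring hmk hml y b) =
        WilsonRP.plaqRe ρ U (ring hmk hml y b) := fun a b hba U s =>
    plaqRe_update_of_not_hasLink ρ _ (fun h => hba (eq_of_hasLink_ring_low hmk hml hkl hL h)) U s
  have hE0 : link (sq k l hkl y) 0 = (y, k) := rfl
  have hE1 : link (sq k l hkl y) 1 = (y.shift k, l) := rfl
  have hE2 : link (sq k l hkl y) 2 = (y.shift l, k) := rfl
  have hE3 : link (sq k l hkl y) 3 = (y, l) := rfl
  -- continuity
  have hc : ∀ (f : GaugeConfig d L G → G), Continuous f → Continuous fun U => reTr ρ (f U) :=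
    fun f hf => Complex.continuous_re.comp (hρ.matrix_trace.comp hf)
  have hU : ∀ e : Edge d L, Continuous fun U : GaugeConfig d L G => U e := fun e => continuous_apply e
  have hP : ∀ q : Plaquette d L, Continuous fun U : GaugeConfig d L G => WilsonRP.plaqRe ρ U q :=
    fun q => continuous_plaqRe ρ hρ q
  -- flipped presentations of the faces `2`, `3` (`Re χ(g⁻¹) = Re χ(g)`)
  have hF2i : ∀ U : GaugeConfig d L G, WilsonRP.plaqRe ρ U (ring hmk hml y 2) =
      reTr ρ (1 * U (y.shift l, k) * (U ((y.shift k).shift l, m) * (U ((y.shift m).shift l, k))⁻¹ *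
        (U (y.shift l, m))⁻¹)) := fun U => by
    rw [hF2, ← hinv]; exact congrArg _ (by group)
  have hF3i : ∀ U : GaugeConfig d L G, WilsonRP.plaqRe ρ U (ring hmk hml y 3) =
      reTr ρ (1 * U (y, l) * (U (y.shift l, m) * (U (y.shift m, l))⁻¹ * (U (y, m))⁻¹)) := fun U => by
    rw [hF3, ← hinv]; exact congrArg _ (by group)
  have hF1' : ∀ U : GaugeConfig d L G, WilsonRP.plaqRe ρ U (ring hmk hml y 1) =
      reTr ρ (U (y.shift k, m) * U ((y.shift m).shift k, l) * (U ((y.shift k).shift l, m))⁻¹ *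
        (U (y.shift k, l))⁻¹ * 1) := fun U => by rw [hF1, mul_one]
  have hF0' : ∀ U : GaugeConfig d L G, WilsonRP.plaqRe ρ U (ring hmk hml y 0) =
      reTr ρ (U (y, m) * U (y.shift m, k) * (U (y.shift k, m))⁻¹ * (U (y, k))⁻¹ * 1) := fun U => by
    rw [hF0, mul_one]
  have hS0' : ∀ U : GaugeConfig d L G, WilsonRP.plaqRe ρ U (sq k l hkl y) =
      reTr ρ (1 * U (y, k) * (U (y.shift k, l) * (U (y.shift l, k))⁻¹ * (U (y, l))⁻¹)) := fun U => by
    rw [hS0]; exact congrArg _ (by group)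
  ---------------------------------------------------------------- Step 1: the edge `(y, k)`
  have step1 : ∫ U, H U * WilsonRP.plaqRe ρ U (sq k l hkl y) *
        ∏ a : Fin 4, WilsonRP.plaqRe ρ U (ring hmk hml y a)
          ∂Measure.pi (fun _ : Edge d L => haarProbability G) =
      c₁ * ∫ U, (H U * WilsonRP.plaqRe ρ U (ring hmk hml y 1) * WilsonRP.plaqRe ρ U (ring hmk hml y 2) *
          WilsonRP.plaqRe ρ U (ring hmk hml y 3)) *
        reTr ρ (1 * (U (y, m) * U (y.shift m, k) * (U (y.shift k, m))⁻¹) *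
          ((U (y.shift k, l) * (U (y.shift l, k))⁻¹ * (U (y, l))⁻¹) * 1))
          ∂Measure.pi (fun _ : Edge d L => haarProbability G) := by
    refine glue ρ hR1 (y, k) ?_ _ (fun U => U (y, m) * U (y.shift m, k) * (U (y.shift k, m))⁻¹)
      (fun _ => 1) (fun _ => 1) (fun U => U (y.shift k, l) * (U (y.shift l, k))⁻¹ * (U (y, l))⁻¹) ?_
    · exact integrable_of_continuous ((hH.mul (hP _)).mul (continuous_finsetProd _ fun a _ => hP _))
    · intro U s
      rw [hfour, hHm (y, k) rfl, ← hE0, hfro 0 1 (by decide), hfro 0 2 (by decide),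
        hfro 0 3 (by decide), hE0, hS0', hF0']
      simp only [update_apply, Prod.mk.injEq, hmk', hml', hkl', hkm, hlm, hlk, s01, s02, s03, s04, s05,
        s06, s12, s13, s23, s14, s25, s34, s35, s16, s26, s24, s15, t01, t02, t03, t04, t05, t06, t12,
        t13, t23, t14, t25, t34, t35, t16, t26, t24, t15, true_and, and_true, false_and, and_false,
        if_true, if_false]
      ring
  ---------------------------------------------------------------- Step 2: the edge `(y+e_k, l)`
  have step2 : ∫ U, (H U * WilsonRP.plaqRe ρ U (ring hmk hml y 1) * WilsonRP.plaqRe ρ U (ring hmk hml y 2) *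
          WilsonRP.plaqRe ρ U (ring hmk hml y 3)) *
        reTr ρ (1 * (U (y, m) * U (y.shift m, k) * (U (y.shift k, m))⁻¹) *
          ((U (y.shift k, l) * (U (y.shift l, k))⁻¹ * (U (y, l))⁻¹) * 1))
          ∂Measure.pi (fun _ : Edge d L => haarProbability G) =
      c₁ * ∫ U, (H U * WilsonRP.plaqRe ρ U (ring hmk hml y 2) * WilsonRP.plaqRe ρ U (ring hmk hml y 3)) *
        reTr ρ (1 * (U (y.shift k, m) * U ((y.shift m).shift k, l) * (U ((y.shift k).shift l, m))⁻¹) *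
          ((U (y.shift l, k))⁻¹ * (U (y, l))⁻¹ * (U (y, m) * U (y.shift m, k) * (U (y.shift k, m))⁻¹)))
          ∂Measure.pi (fun _ : Edge d L => haarProbability G) := by
    refine glue ρ hR1 (y.shift k, l) ?_ _
      (fun U => U (y.shift k, m) * U ((y.shift m).shift k, l) * (U ((y.shift k).shift l, m))⁻¹)
      (fun _ => 1) (fun U => U (y, m) * U (y.shift m, k) * (U (y.shift k, m))⁻¹)
      (fun U => (U (y.shift l, k))⁻¹ * (U (y, l))⁻¹) ?_
    · have hw : Continuous fun U : GaugeConfig d L G =>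
          (1 : G) * (U (y, m) * U (y.shift m, k) * (U (y.shift k, m))⁻¹) *
            ((U (y.shift k, l) * (U (y.shift l, k))⁻¹ * (U (y, l))⁻¹) * 1) := by fun_prop
      exact integrable_of_continuous ((((hH.mul (hP _)).mul (hP _)).mul (hP _)).mul (hc _ hw))
    · intro U s
      rw [hHm (y.shift k, l) (WilsonRP.shift_apply_of_ne y hmk'), ← hE1, hfro 1 2 (by decide),
        hfro 1 3 (by decide), hE1, hF1']
      simp only [update_apply, Prod.mk.injEq, hmk', hml', hkl', hkm, hlm, hlk, s01, s02, s03, s04, s05,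
        s06, s12, s13, s23, s14, s25, s34, s35, s16, s26, s24, s15, t01, t02, t03, t04, t05, t06, t12,
        t13, t23, t14, t25, t34, t35, t16, t26, t24, t15, true_and, and_true, false_and, and_false,
        if_true, if_false]
      have e1 : (1 : G) * (U (y, m) * U (y.shift m, k) * (U (y.shift k, m))⁻¹) *
          (s * (U (y.shift l, k))⁻¹ * (U (y, l))⁻¹ * 1) =
          U (y, m) * U (y.shift m, k) * (U (y.shift k, m))⁻¹ * s * ((U (y.shift l, k))⁻¹ * (U (y, l))⁻¹) := by
        group
      rw [e1]
      ring
  ---------------------------------------------------------------- Step 3: the edge `(y+e_l, k)`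
  have step3 : ∫ U, (H U * WilsonRP.plaqRe ρ U (ring hmk hml y 2) * WilsonRP.plaqRe ρ U (ring hmk hml y 3)) *
        reTr ρ (1 * (U (y.shift k, m) * U ((y.shift m).shift k, l) * (U ((y.shift k).shift l, m))⁻¹) *
          ((U (y.shift l, k))⁻¹ * (U (y, l))⁻¹ * (U (y, m) * U (y.shift m, k) * (U (y.shift k, m))⁻¹)))
          ∂Measure.pi (fun _ : Edge d L => haarProbability G) =
      c₁ * ∫ U, (H U * WilsonRP.plaqRe ρ U (ring hmk hml y 3)) *
        reTr ρ ((U (y, l))⁻¹ * (U (y, m) * U (y.shift m, k) * U ((y.shift m).shift k, l) *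
          (U ((y.shift k).shift l, m))⁻¹) *
          ((U ((y.shift k).shift l, m) * (U ((y.shift m).shift l, k))⁻¹ * (U (y.shift l, m))⁻¹) * 1))
          ∂Measure.pi (fun _ : Edge d L => haarProbability G) := by
    -- re-present the word with the letter `(y+e_l, k)⁻¹` exposed (conjugate by `V0 E'0 V1⁻¹`)
    have hw : ∀ U : GaugeConfig d L G,
        reTr ρ (1 * (U (y.shift k, m) * U ((y.shift m).shift k, l) * (U ((y.shift k).shift l, m))⁻¹) *
          ((U (y.shift l, k))⁻¹ * (U (y, l))⁻¹ * (U (y, m) * U (y.shift m, k) * (U (y.shift k, m))⁻¹))) =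
        reTr ρ ((U (y, m) * U (y.shift m, k) * U ((y.shift m).shift k, l) * (U ((y.shift k).shift l, m))⁻¹) *
          (U (y.shift l, k))⁻¹ * (U (y, l))⁻¹) := fun U => by
      rw [← reTr_conj ρ (U (y, m) * U (y.shift m, k) * (U (y.shift k, m))⁻¹)]
      exact congrArg _ (by group)
    simp_rw [hw]
    refine glue ρ hR1 (y.shift l, k) ?_ _
      (fun U => U (y, m) * U (y.shift m, k) * U ((y.shift m).shift k, l) * (U ((y.shift k).shift l, m))⁻¹)
      (fun U => (U (y, l))⁻¹) (fun _ => 1)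
      (fun U => U ((y.shift k).shift l, m) * (U ((y.shift m).shift l, k))⁻¹ * (U (y.shift l, m))⁻¹) ?_
    · have hw : Continuous fun U : GaugeConfig d L G =>
          (U (y, m) * U (y.shift m, k) * U ((y.shift m).shift k, l) * (U ((y.shift k).shift l, m))⁻¹) *
            (U (y.shift l, k))⁻¹ * (U (y, l))⁻¹ := by fun_prop
      exact integrable_of_continuous (((hH.mul (hP _)).mul (hP _)).mul (hc _ hw))
    · intro U s
      rw [hHm (y.shift l, k) (WilsonRP.shift_apply_of_ne y hml'), ← hE2, hfro 2 3 (by decide), hE2, hF2i]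
      simp only [update_apply, Prod.mk.injEq, hmk', hml', hkl', hkm, hlm, hlk, s01, s02, s03, s04, s05,
        s06, s12, s13, s23, s14, s25, s34, s35, s16, s26, s24, s15, t01, t02, t03, t04, t05, t06, t12,
        t13, t23, t14, t25, t34, t35, t16, t26, t24, t15, true_and, and_true, false_and, and_false,
        if_true, if_false]
      ring
  ---------------------------------------------------------------- Step 4: the edge `(y, l)`
  have step4 : ∫ U, (H U * WilsonRP.plaqRe ρ U (ring hmk hml y 3)) *
        reTr ρ ((U (y, l))⁻¹ * (U (y, m) * U (y.shift m, k) * U ((y.shift m).shift k, l) *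
          (U ((y.shift k).shift l, m))⁻¹) *
          ((U ((y.shift k).shift l, m) * (U ((y.shift m).shift l, k))⁻¹ * (U (y.shift l, m))⁻¹) * 1))
          ∂Measure.pi (fun _ : Edge d L => haarProbability G) =
      c₁ * ∫ U, H U * reTr ρ (1 * (U (y, m) * U (y.shift m, k) * U ((y.shift m).shift k, l) *
          (U ((y.shift m).shift l, k))⁻¹ * (U (y.shift l, m))⁻¹) *
          ((U (y.shift l, m) * (U (y.shift m, l))⁻¹ * (U (y, m))⁻¹) * 1))
          ∂Measure.pi (fun _ : Edge d L => haarProbability G) := by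
    -- re-present the word with the letter `(y, l)⁻¹` exposed (conjugate by `E3`)
    have hw : ∀ U : GaugeConfig d L G,
        reTr ρ ((U (y, l))⁻¹ * (U (y, m) * U (y.shift m, k) * U ((y.shift m).shift k, l) *
          (U ((y.shift k).shift l, m))⁻¹) *
          ((U ((y.shift k).shift l, m) * (U ((y.shift m).shift l, k))⁻¹ * (U (y.shift l, m))⁻¹) * 1)) =
        reTr ρ ((U (y, m) * U (y.shift m, k) * U ((y.shift m).shift k, l) *
          (U ((y.shift m).shift l, k))⁻¹ * (U (y.shift l, m))⁻¹) * (U (y, l))⁻¹ * 1) := fun U => by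
      rw [← reTr_conj ρ (U (y, l))]
      exact congrArg _ (by group)
    simp_rw [hw]
    refine glue ρ hR1 (y, l) ?_ _
      (fun U => U (y, m) * U (y.shift m, k) * U ((y.shift m).shift k, l) *
        (U ((y.shift m).shift l, k))⁻¹ * (U (y.shift l, m))⁻¹)
      (fun _ => 1) (fun _ => 1) (fun U => U (y.shift l, m) * (U (y.shift m, l))⁻¹ * (U (y, m))⁻¹) ?_
    · have hw : Continuous fun U : GaugeConfig d L G =>
          (U (y, m) * U (y.shift m, k) * U ((y.shift m).shift k, l) *
            (U ((y.shift m).shift l, k))⁻¹ * (U (y.shift l, m))⁻¹) * (U (y, l))⁻¹ * 1 := by fun_prop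
      exact integrable_of_continuous ((hH.mul (hP _)).mul (hc _ hw))
    · intro U s
      rw [hHm (y, l) rfl, hF3i]
      simp only [update_apply, Prod.mk.injEq, hmk', hml', hkl', hkm, hlm, hlk, s01, s02, s03, s04, s05,
        s06, s12, s13, s23, s14, s25, s34, s35, s16, s26, s24, s15, t01, t02, t03, t04, t05, t06, t12,
        t13, t23, t14, t25, t34, t35, t16, t26, t24, t15, true_and, and_true, false_and, and_false,
        if_true, if_false]
      ring
  ---------------------------------------------------------------- Conclusion
  have hfin : ∀ U : GaugeConfig d L G, H U * reTr ρ (1 * (U (y, m) * U (y.shift m, k) *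
      U ((y.shift m).shift k, l) * (U ((y.shift m).shift l, k))⁻¹ * (U (y.shift l, m))⁻¹) *
        ((U (y.shift l, m) * (U (y.shift m, l))⁻¹ * (U (y, m))⁻¹) * 1)) =
      H U * WilsonRP.plaqRe ρ U (sq k l hkl (y.shift m)) := fun U => by
    rw [hS1, ← reTr_conj ρ (U (y, m))⁻¹]
    congr 1
    exact congrArg _ (by group)
  rw [step1, step2, step3, step4, integral_congr_ae (ae_of_all _ hfin)]
  ring

end Collapse

end DiagRPTube

end

end Summit.QuantumFields.GaugeBoot
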